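import Mathlib
import HarnessLib

/-!
# Two digraph lemmas for the closedness of the principal minor image (Lin–Sturmfels 2009, Thm. 1)

Elementary combinatorics used in `PrincipalMinorMapProofs.lean` (the proof of Theorem 1 of
Shaowei Lin, Bernd Sturmfels, *Polynomial relations among principal minors of a `4 × 4`-matrix*,
J. Algebra **322** (2009) 4121–4131 [LinSturmfels2009]) in place of the toric-geometry input
[LinSturmfels2009], Lemma 9 (closed image of the cycle monomial map, via [GMS], [KT]):

* `LinSturmfels.exists_cycle_of_closedWalk` — a closed walk of a relation `H` on a finite type
  contains a loop `H a a` or a simple cycle: a cyclic permutation `σ` with `H z (σ z)` for every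
  `z` it moves (shortest closed sub-walk; cycles are encoded as cyclic permutations to match the
  cycle monomials `∏_{z ∈ supp σ} B z (σ z)` of [LinSturmfels2009], §2);
* `LinSturmfels.exists_heavy_cycle` — a nonnegative weight `p` on the complete digraph on `n`
  vertices which is *balanced* (`Σ_j p i j = Σ_j p j i` for all `i`) and has a positive entry
  `p u v` carries a loop or a simple cycle all of whose edges have weight `≥ p u v / (2 n²)`
  (if `u` is not reachable from `v` along such heavy edges, flow conservation across the cut
  "reachable from `v`" is violated).

Both are folklore; they enter the Kempf–Ness-type compactness argument replacing
[LinSturmfels2009], Cor. 8 and Lemma 9 (see the module docstring of `PrincipalMinorMapProofs`).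
-/

noncomputable section

open Equiv Finset

namespace Literature.LinearAlgebra.Matrix

namespace LinSturmfels

variable {V : Type*} [Fintype V] [DecidableEq V]

/-- **Closed walks contain simple cycles.** If `L = [v₀, …, v_{N-1}]` is a nonempty `H`-chain
(`H vₜ vₜ₊₁`) closing up (`H v_{N-1} v₀`), then either `H a a` for some `a`, or there is a
cyclic permutation `σ` of `V` with `H z (σ z)` for every `z ∈ supp σ`.  Proof: strong induction
on `N`; a walk without repeated vertex is itself such a cycle (`List.formPerm`), otherwise the
sub-walk between two occurrences of a repeated vertex is a shorter closed walk. [folklore] -/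
theorem exists_cycle_of_closedWalk (H : V → V → Prop) :
    ∀ (N : ℕ) (L : List V) (hL : L ≠ []), L.length = N → List.IsChain H L →
      H (L.getLast hL) (L.head hL) →
      (∃ a, H a a) ∨ ∃ σ : Perm V, σ.IsCycle ∧ ∀ z ∈ σ.support, H z (σ z) := by
  intro N
  induction N using Nat.strong_induction_on with
  | _ N ih =>
  intro L hL hN hchain hclose
  by_cases hnd : L.Nodup
  · by_cases h2 : 2 ≤ L.length
    · right
      refine ⟨L.formPerm, List.isCycle_formPerm hnd h2, fun z hz => ?_⟩
      rw [List.support_formPerm_of_nodup L hnd (fun a h => by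
        have := congrArg List.length h; simp at this; omega)] at hz
      obtain ⟨i, hi, rfl⟩ := List.getElem_of_mem (List.mem_toFinset.mp hz)
      rw [List.formPerm_apply_getElem _ hnd]
      by_cases hlt : i + 1 < L.length
      · simp only [Nat.mod_eq_of_lt hlt]
        exact List.isChain_iff_getElem.mp hchain i hlt
      · have heq : i + 1 = L.length := by omega
        simp only [heq, Nat.mod_self]
        have h1 : L[i] = L.getLast hL := by
          rw [List.getLast_eq_getElem]
          exact getElem_congr_idx (by omega)
        have h2 : L[0] = L.head hL := (List.head_eq_getElem hL).symm
        rw [h1, h2]; exact hclose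
    · left
      obtain ⟨a, rfl⟩ : ∃ a, L = [a] :=
        List.length_eq_one_iff.mp (by have := List.length_pos_iff.mpr hL; omega)
      exact ⟨a, by simpa using hclose⟩
  · rw [List.nodup_iff_injective_get, Function.not_injective_iff] at hnd
    obtain ⟨a, b, hab, hne⟩ := hnd
    have key : ∀ a b : Fin L.length, a < b → L.get a = L.get b →
        (∃ a, H a a) ∨ ∃ σ : Perm V, σ.IsCycle ∧ ∀ z ∈ σ.support, H z (σ z) := by
      intro a b hlt heq
      simp only [List.get_eq_getElem] at heq
      have hbL : (b : ℕ) < L.length := b.2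
      have hab' : (a : ℕ) < b := hlt
      set L' := (L.drop a).take (b - a) with hL'
      have hlen' : L'.length = b - a := by
        simp only [hL', List.length_take, List.length_drop]; omega
      have hL'ne : L' ≠ [] := List.ne_nil_of_length_pos (by rw [hlen']; omega)
      have hinf : L' <:+: L :=
        ((List.take_prefix _ _).isInfix).trans (List.drop_suffix _ _).isInfix
      have hchain' : List.IsChain H L' := hchain.infix hinf
      have hget' : ∀ (t : ℕ) (ht : t < L'.length), L'[t] = L[(a : ℕ) + t]'(by omega) := by
        intro t ht; simp [hL', List.getElem_take, List.getElem_drop]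
      have hclose' : H (L'.getLast hL'ne) (L'.head hL'ne) := by
        rw [List.getLast_eq_getElem, List.head_eq_getElem, hget', hget']
        have e1 : L[(a : ℕ) + (L'.length - 1)]'(by omega) = L[(b : ℕ) - 1]'(by omega) :=
          getElem_congr_idx (by omega)
        have e2 : L[(a : ℕ) + 0]'(by omega) = L[(b : ℕ) - 1 + 1]'(by omega) := by
          rw [getElem_congr_idx (Nat.add_zero a), heq]
          exact getElem_congr_idx (by omega)
        rw [e1, e2]
        exact List.isChain_iff_getElem.mp hchain (b - 1) (by omega)
      exact ih _ (by omega) L' hL'ne hlen' hchain' hclose'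
    rcases lt_or_gt_of_ne hne with h | h
    · exact key a b h hab
    · exact key b a h hab.symm

/-- **Balanced digraphs have heavy cycles.** Let `p : V → V → ℝ` be nonnegative and balanced
(`Σ_j p i j = Σ_j p j i` for every `i`; loops allowed) on a type with `n` elements, and let
`p u v > 0`.  Then there is a loop `a` or a cyclic permutation `σ` all of whose edges
`(z, σ z)`, `z ∈ supp σ` (resp. `(a, a)`), have weight at least `p u v / (2 n²)`.  Proof: call an
edge heavy if its weight is `≥ θ := p u v / (2 n²)`.  If `u` is reachable from `v` by heavy edges,
the heavy edge `u → v` closes a heavy walk and `exists_cycle_of_closedWalk` applies.  Otherwise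
let `U ∋ v`, `U ∌ u` be the set of vertices heavily reachable from `v`; by balance the total
weight leaving `U` equals the total weight entering `U`, which is `≥ p u v`; but every edge leaving
`U` is light, so the weight leaving `U` is `≤ |U| |Uᶜ| θ ≤ p u v / 2`, a contradiction.
[folklore] -/
theorem exists_heavy_cycle (p : V → V → ℝ) (hp : ∀ i j, 0 ≤ p i j)
    (hbal : ∀ i, ∑ j, p i j = ∑ j, p j i) (u v : V) (hpos : 0 < p u v) :
    (∃ a, p u v / (2 * (Fintype.card V : ℝ) ^ 2) ≤ p a a) ∨
      ∃ σ : Perm V, σ.IsCycle ∧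
        ∀ z ∈ σ.support, p u v / (2 * (Fintype.card V : ℝ) ^ 2) ≤ p z (σ z) := by
  classical
  set θ := p u v / (2 * (Fintype.card V : ℝ) ^ 2) with hθ
  set H : V → V → Prop := fun a b => θ ≤ p a b with hH
  have hn : (1 : ℝ) ≤ Fintype.card V := by
    have : Nonempty V := ⟨u⟩
    exact_mod_cast Fintype.card_pos (α := V)
  have hθpos : 0 < θ := by positivity
  have hθle : θ ≤ p u v := by
    rw [hθ]; apply div_le_self hpos.le; nlinarith
  change (∃ a, H a a) ∨ ∃ σ : Perm V, σ.IsCycle ∧ ∀ z ∈ σ.support, H z (σ z)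
  by_cases hu : Relation.ReflTransGen H v u
  · obtain ⟨l, hchain, hlast⟩ := List.exists_isChain_cons_of_relationReflTransGen hu
    refine exists_cycle_of_closedWalk H _ (v :: l) (List.cons_ne_nil v l) rfl hchain ?_
    rw [hlast, List.head_cons]; exact hθle
  · exfalso
    set U : Finset V := Finset.univ.filter (fun w => Relation.ReflTransGen H v w) with hU
    have hvU : v ∈ U := Finset.mem_filter.mpr ⟨Finset.mem_univ _, Relation.ReflTransGen.refl⟩
    have huU : u ∈ Uᶜ := Finset.mem_compl.mpr (fun h => hu (Finset.mem_filter.mp h).2)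
    have hsmall : ∀ w ∈ U, ∀ j ∈ Uᶜ, p w j ≤ θ := by
      intro w hw j hj
      by_contra hlt
      push Not at hlt
      have : j ∈ U := Finset.mem_filter.mpr
        ⟨Finset.mem_univ _, (Finset.mem_filter.mp hw).2.tail hlt.le⟩
      exact (Finset.mem_compl.mp hj) this
    -- flow conservation across the cut `(U, Uᶜ)`
    have hflow : ∑ w ∈ U, ∑ j ∈ Uᶜ, p w j = ∑ w ∈ U, ∑ j ∈ Uᶜ, p j w := by
      have h1 : ∑ w ∈ U, ∑ j, p w j = ∑ w ∈ U, ∑ j, p j w :=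
        Finset.sum_congr rfl (fun w _ => hbal w)
      simp only [← Finset.sum_add_sum_compl U] at h1
      rw [Finset.sum_add_distrib, Finset.sum_add_distrib,
        Finset.sum_comm (s := U) (t := U)] at h1
      linarith
    have hlow : p u v ≤ ∑ w ∈ U, ∑ j ∈ Uᶜ, p j w := by
      calc p u v ≤ ∑ j ∈ Uᶜ, p j v :=
            Finset.single_le_sum (f := fun j => p j v) (fun j _ => hp j v) huU
        _ ≤ ∑ w ∈ U, ∑ j ∈ Uᶜ, p j w :=
            Finset.single_le_sum (f := fun w => ∑ j ∈ Uᶜ, p j w)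
              (fun w _ => Finset.sum_nonneg (fun j _ => hp j w)) hvU
    have hup : ∑ w ∈ U, ∑ j ∈ Uᶜ, p w j ≤ (Fintype.card V) * ((Fintype.card V) * θ) := by
      calc ∑ w ∈ U, ∑ j ∈ Uᶜ, p w j ≤ ∑ w ∈ U, ∑ j ∈ Uᶜ, θ :=
            Finset.sum_le_sum (fun w hw => Finset.sum_le_sum (fun j hj => hsmall w hw j hj))
        _ = U.card * (Uᶜ.card * θ) := by simp [Finset.sum_const, nsmul_eq_mul]
        _ ≤ (Fintype.card V) * ((Fintype.card V) * θ) := by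
          have h1 : (U.card : ℝ) ≤ Fintype.card V := by exact_mod_cast Finset.card_le_univ U
          have h2 : (Uᶜ.card : ℝ) ≤ Fintype.card V := by exact_mod_cast Finset.card_le_univ Uᶜ
          have h3 : (0 : ℝ) ≤ Uᶜ.card * θ := by positivity
          calc (U.card : ℝ) * (Uᶜ.card * θ) ≤ (Fintype.card V) * (Uᶜ.card * θ) :=
                mul_le_mul_of_nonneg_right h1 h3
            _ ≤ (Fintype.card V) * ((Fintype.card V) * θ) :=
                mul_le_mul_of_nonneg_left (mul_le_mul_of_nonneg_right h2 hθpos.le)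
                  (by positivity)
    have hnθ : (Fintype.card V : ℝ) * ((Fintype.card V) * θ) = p u v / 2 := by
      rw [hθ]; field_simp
    linarith

end LinSturmfels

end Literature.LinearAlgebra.Matrix
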